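import Mathlib
import Summits.AtomisticToContinuum.Crystallization.Theorems.ChessboardParticlePlanesLjLaminarWindowsMinDistDefs
import Summits.AtomisticToContinuum.Crystallization.Theorems.ChessboardParticlePlanesLjLaminarWindowsForceTheta
import Literature.MathematicalPhysics.StatisticalMechanics.Yuhjtman2015Proofs
import HarnessLib

/-!
# The near-cut-off inequality (♣) for the charged minus-energy

Stub `stub_forceClubsuit` of line `Sketch`, crux `LjLaminarWindows`
(stmt-AtomisticToContinuum-6711):
for `c ∈ [171/500, 7/20]` and `4/5 ≤ r ≤ 16/25 + c` there is an upper limit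
`U ∈ [16/25, min (r + c, 3/2)]` with
`(4/3) c³ · r kF(r) ≤ ∫_{16/25}^{U} (AF - BF v)(c² - (v - r)²) dv`
(Yuhjtman's inequality (♣) of Prop. 5 II, `Yuhjtman2015.clubsuit`, with `h` replaced by the charged
minus-energy `kF = h + (1/25)|h'|` and the tangent data `(A, B)` by `(AF, BF)`).

Proof.  Four pieces in `r`, with `U = r₁ + 171/500 ≤ r + c` and a constant bound `kF ≤ ḡ`:
`[4/5, 17/20]` (`U = 571/500`, `ḡ = 4/5`), `[17/20, 9/10]` (`U = 149/125`, `ḡ = 6/5`),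
`[9/10, 19/20]` (`U = 621/500`, `ḡ = 6/5`), `[19/20, 99/100]` (`U = 323/250`, `ḡ = 23/20`).
On each piece: `kF ≤ ḡ` is the polynomial inequality `ḡ v¹³ - 2v⁷ + v - 12/25 + (12/25)v⁶ ≥ 0`
(positive Bernstein coefficients, `forceTheta_bernstein`); the integral is the explicit polynomial
`M₀ c² - M₀ r² + 2 M₁ r - M₂` (`forceClubsuit_integral`); and
`G(c, r) = M₀ c² - M₀ r² + 2 M₁ r - M₂ - (4/3) c³ r ḡ ≥ 0` on the box `[171/500, 7/20] × [r₁, r₂]`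
because `G` is concave in `r` and both edges `G(·, r₁)`, `G(·, r₂)` are cubics in `c` with positive
Bernstein coefficients on `[171/500, 7/20]`: one `linarith` call finds the certificate
`(r₂ - r₁) G(c,r) = (r₂ - r) G(c,r₁) + (r - r₁) G(c,r₂) + M₀ (r - r₁)(r₂ - r)(r₂ - r₁)` from the
nine products of `forceClubsuit_hints` (all margins `≥ 7 %`, lead's exact arithmetic
`work/numerics/edges.py`).
-/

noncomputable section

open MeasureTheory intervalIntegral Set Literature.MathematicalPhysics.StatisticalMechanics
open Literature.MathematicalPhysics.StatisticalMechanics.Yuhjtman2015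

namespace Summit.AtomisticToContinuum.Crystallization.Theorems.LjLaminarWindowsSketch

/-- **The integral of (♣), evaluated**: `∫_{16/25}^{U} (AF - BF v)(c² - (v-r)²) dv
= M₀ c² - M₀ r² + 2 M₁ r - M₂` with
`M_k = AF (U^{k+1} - m^{k+1})/(k+1) - BF (U^{k+2} - m^{k+2})/(k+2)`, `m = 16/25`
(pattern `Yuhjtman2015.integral_clubsuit_lo`). [folklore] -/
theorem forceClubsuit_integral (c r U : ℝ) :
    ∫ v in (16 / 25 : ℝ)..U, (AF - BF * v) * (c ^ 2 - (v - r) ^ 2) =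
      (AF * (U - 16 / 25) - BF * (U ^ 2 - (16 / 25) ^ 2) / 2) * c ^ 2
        - (AF * (U - 16 / 25) - BF * (U ^ 2 - (16 / 25) ^ 2) / 2) * r ^ 2
        + 2 * (AF * (U ^ 2 - (16 / 25) ^ 2) / 2 - BF * (U ^ 3 - (16 / 25) ^ 3) / 3) * r
        - (AF * (U ^ 3 - (16 / 25) ^ 3) / 3 - BF * (U ^ 4 - (16 / 25) ^ 4) / 4) := by
  set p₀ : ℝ := AF * (c ^ 2 - r ^ 2) with hp₀
  set p₁ : ℝ := 2 * AF * r - BF * (c ^ 2 - r ^ 2) with hp₁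
  set p₂ : ℝ := -AF - 2 * BF * r with hp₂
  set p₃ : ℝ := BF with hp₃
  have hderiv : ∀ v, HasDerivAt
      (fun v : ℝ ↦ p₀ * v + p₁ * v ^ 2 / 2 + p₂ * v ^ 3 / 3 + p₃ * v ^ 4 / 4)
      ((AF - BF * v) * (c ^ 2 - (v - r) ^ 2)) v := by
    intro v
    have h := ((((hasDerivAt_id' v).const_mul p₀).fun_add
      ((((hasDerivAt_id' v).fun_pow 2).const_mul p₁).div_const 2)).fun_add
      ((((hasDerivAt_id' v).fun_pow 3).const_mul p₂).div_const 3)).fun_add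
      ((((hasDerivAt_id' v).fun_pow 4).const_mul p₃).div_const 4)
    refine h.congr_deriv ?_
    rw [hp₀, hp₁, hp₂, hp₃]
    norm_num
    ring
  rw [integral_eq_sub_of_hasDerivAt (fun v _ ↦ hderiv v)
    ((by fun_prop : Continuous fun v : ℝ ↦ (AF - BF * v) * (c ^ 2 - (v - r) ^ 2)).intervalIntegrable
      _ _)]
  rw [hp₀, hp₁, hp₂, hp₃]
  ring

/-- The nine nonnegative products behind the concavity-in-`r` / Bernstein-in-`c` certificate:
`a = r - r₁`, `b = r₂ - r`, `u = c - 171/500`, `w = 7/20 - c`. [folklore] -/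
theorem forceClubsuit_hints {a b u w : ℝ} (ha : 0 ≤ a) (hb : 0 ≤ b) (hu : 0 ≤ u) (hw : 0 ≤ w) :
    0 ≤ a * b ∧ 0 ≤ a * u ^ 3 ∧ 0 ≤ a * (u ^ 2 * w) ∧ 0 ≤ a * (u * w ^ 2) ∧ 0 ≤ a * w ^ 3 ∧
      0 ≤ b * u ^ 3 ∧ 0 ≤ b * (u ^ 2 * w) ∧ 0 ≤ b * (u * w ^ 2) ∧ 0 ≤ b * w ^ 3 :=
  ⟨mul_nonneg ha hb, mul_nonneg ha (pow_nonneg hu 3),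
    mul_nonneg ha (mul_nonneg (pow_nonneg hu 2) hw),
    mul_nonneg ha (mul_nonneg hu (pow_nonneg hw 2)), mul_nonneg ha (pow_nonneg hw 3),
    mul_nonneg hb (pow_nonneg hu 3), mul_nonneg hb (mul_nonneg (pow_nonneg hu 2) hw),
    mul_nonneg hb (mul_nonneg hu (pow_nonneg hw 2)), mul_nonneg hb (pow_nonneg hw 3)⟩

/-! ### The constant bounds `kF ≤ ḡ` (positive Bernstein coefficients of `ḡ v¹³ - v¹³ kF(v)`) -/

/-- `kF ≤ 4/5` on `[4/5, 17/20]`. [folklore] -/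
theorem forceClubsuit_kF_le₁ {v : ℝ} (h1 : 4 / 5 ≤ v) (h2 : v ≤ 17 / 20) : kF v ≤ 4 / 5 := by
  rw [forceTheta_kF_of_le_one (by linarith) (by linarith), div_le_iff₀ (by positivity)]
  obtain ⟨c0, c1, c2, c3, c4, c5, c6, c7, c8, c9, c10, c11, c12, c13⟩ := forceTheta_bernstein h1 h2
  linarith

/-- `kF ≤ 6/5` on `[17/20, 19/20]`. [folklore] -/
theorem forceClubsuit_kF_le₂ {v : ℝ} (h1 : 17 / 20 ≤ v) (h2 : v ≤ 19 / 20) : kF v ≤ 6 / 5 := by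
  rw [forceTheta_kF_of_le_one (by linarith) (by linarith), div_le_iff₀ (by positivity)]
  obtain ⟨c0, c1, c2, c3, c4, c5, c6, c7, c8, c9, c10, c11, c12, c13⟩ := forceTheta_bernstein h1 h2
  linarith

/-- `kF ≤ 23/20` on `[19/20, 99/100]`. [folklore] -/
theorem forceClubsuit_kF_le₃ {v : ℝ} (h1 : 19 / 20 ≤ v) (h2 : v ≤ 99 / 100) : kF v ≤ 23 / 20 := by
  rw [forceTheta_kF_of_le_one (by linarith) (by linarith), div_le_iff₀ (by positivity)]
  obtain ⟨c0, c1, c2, c3, c4, c5, c6, c7, c8, c9, c10, c11, c12, c13⟩ := forceTheta_bernstein h1 h2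
  linarith

/-! ### The four pieces: `(4/3) c³ r ḡ ≤ ∫_{16/25}^{U} (AF - BF v)(c² - (v-r)²) dv` -/

/-- Piece 1: `r ∈ [4/5, 17/20]`, `U = 571/500`, `ḡ = 4/5`. [folklore] -/
theorem forceClubsuit_piece₁ {c r : ℝ} (hc1 : 171 / 500 ≤ c) (hc2 : c ≤ 7 / 20) (hr1 : 4 / 5 ≤ r)
    (hr2 : r ≤ 17 / 20) : 4 / 3 * c ^ 3 * r * (4 / 5) ≤
      ∫ v in (16 / 25 : ℝ)..(571 / 500), (AF - BF * v) * (c ^ 2 - (v - r) ^ 2) := by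
  rw [forceClubsuit_integral]
  obtain ⟨h0, h1, h2, h3, h4, h5, h6, h7, h8⟩ := forceClubsuit_hints (sub_nonneg.2 hr1)
    (sub_nonneg.2 hr2) (sub_nonneg.2 hc1) (sub_nonneg.2 hc2)
  unfold AF BF
  linarith

/-- Piece 2: `r ∈ [17/20, 9/10]`, `U = 149/125`, `ḡ = 6/5`. [folklore] -/
theorem forceClubsuit_piece₂ {c r : ℝ} (hc1 : 171 / 500 ≤ c) (hc2 : c ≤ 7 / 20) (hr1 : 17 / 20 ≤ r)
    (hr2 : r ≤ 9 / 10) : 4 / 3 * c ^ 3 * r * (6 / 5) ≤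
      ∫ v in (16 / 25 : ℝ)..(149 / 125), (AF - BF * v) * (c ^ 2 - (v - r) ^ 2) := by
  rw [forceClubsuit_integral]
  obtain ⟨h0, h1, h2, h3, h4, h5, h6, h7, h8⟩ := forceClubsuit_hints (sub_nonneg.2 hr1)
    (sub_nonneg.2 hr2) (sub_nonneg.2 hc1) (sub_nonneg.2 hc2)
  unfold AF BF
  linarith

/-- Piece 3: `r ∈ [9/10, 19/20]`, `U = 621/500`, `ḡ = 6/5`. [folklore] -/
theorem forceClubsuit_piece₃ {c r : ℝ} (hc1 : 171 / 500 ≤ c) (hc2 : c ≤ 7 / 20) (hr1 : 9 / 10 ≤ r)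
    (hr2 : r ≤ 19 / 20) : 4 / 3 * c ^ 3 * r * (6 / 5) ≤
      ∫ v in (16 / 25 : ℝ)..(621 / 500), (AF - BF * v) * (c ^ 2 - (v - r) ^ 2) := by
  rw [forceClubsuit_integral]
  obtain ⟨h0, h1, h2, h3, h4, h5, h6, h7, h8⟩ := forceClubsuit_hints (sub_nonneg.2 hr1)
    (sub_nonneg.2 hr2) (sub_nonneg.2 hc1) (sub_nonneg.2 hc2)
  unfold AF BF
  linarith

/-- Piece 4: `r ∈ [19/20, 99/100]`, `U = 323/250`, `ḡ = 23/20`. [folklore] -/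
theorem forceClubsuit_piece₄ {c r : ℝ} (hc1 : 171 / 500 ≤ c) (hc2 : c ≤ 7 / 20) (hr1 : 19 / 20 ≤ r)
    (hr2 : r ≤ 99 / 100) : 4 / 3 * c ^ 3 * r * (23 / 20) ≤
      ∫ v in (16 / 25 : ℝ)..(323 / 250), (AF - BF * v) * (c ^ 2 - (v - r) ^ 2) := by
  rw [forceClubsuit_integral]
  obtain ⟨h0, h1, h2, h3, h4, h5, h6, h7, h8⟩ := forceClubsuit_hints (sub_nonneg.2 hr1)
    (sub_nonneg.2 hr2) (sub_nonneg.2 hc1) (sub_nonneg.2 hc2)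
  unfold AF BF
  linarith

/-- Assembly of one piece: `kF r ≤ ḡ` and `(4/3) c³ r ḡ ≤ I` give `(4/3) c³ (r kF r) ≤ I`.
[folklore] -/
theorem forceClubsuit_assemble {c r g I : ℝ} (hc : 0 ≤ c) (hr : 0 ≤ r) (hk : kF r ≤ g)
    (hI : 4 / 3 * c ^ 3 * r * g ≤ I) : 4 / 3 * c ^ 3 * (r * kF r) ≤ I :=
  calc 4 / 3 * c ^ 3 * (r * kF r) = 4 / 3 * c ^ 3 * r * kF r := by ring
    _ ≤ 4 / 3 * c ^ 3 * r * g := mul_le_mul_of_nonneg_left hk (by positivity)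
    _ ≤ I := hI

/-- **The near-cut-off inequality (♣) for the charged minus-energy** (registered stub
`stub_forceClubsuit`, line `Sketch`, crux `LjLaminarWindows`): for `c ∈ [171/500, 7/20]` and
`4/5 ≤ r ≤ 16/25 + c` there is `U ∈ [16/25, min (r + c, 3/2)]` with
`(4/3) c³ · r kF(r) ≤ ∫_{16/25}^{U} (AF - BF v)(c² - (v - r)²) dv`; piecewise in `r` with
`U = r₁ + 171/500` and the constant bounds `kF ≤ ḡ`. [folklore] -/
theorem stub_forceClubsuit : ForceClubsuitFacts := by
  unfold ForceClubsuitFacts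
  intro c r hc1 hc2 hr1 hr2
  have hc0 : 0 ≤ c := by linarith
  have hr0 : 0 ≤ r := by linarith
  rcases le_total r (17 / 20) with h₁ | h₁
  · exact ⟨571 / 500, by norm_num, by linarith, by norm_num, forceClubsuit_assemble hc0 hr0
      (forceClubsuit_kF_le₁ hr1 h₁) (forceClubsuit_piece₁ hc1 hc2 hr1 h₁)⟩
  rcases le_total r (9 / 10) with h₂ | h₂
  · exact ⟨149 / 125, by norm_num, by linarith, by norm_num, forceClubsuit_assemble hc0 hr0
      (forceClubsuit_kF_le₂ h₁ (by linarith)) (forceClubsuit_piece₂ hc1 hc2 h₁ h₂)⟩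
  rcases le_total r (19 / 20) with h₃ | h₃
  · exact ⟨621 / 500, by norm_num, by linarith, by norm_num, forceClubsuit_assemble hc0 hr0
      (forceClubsuit_kF_le₂ (by linarith) h₃) (forceClubsuit_piece₃ hc1 hc2 h₂ h₃)⟩
  · have h₄ : r ≤ 99 / 100 := by linarith
    exact ⟨323 / 250, by norm_num, by linarith, by norm_num, forceClubsuit_assemble hc0 hr0
      (forceClubsuit_kF_le₃ h₃ h₄) (forceClubsuit_piece₄ hc1 hc2 h₃ h₄)⟩

end Summit.AtomisticToContinuum.Crystallization.Theorems.LjLaminarWindowsSketch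

end
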